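import Summits.ValiantsHypothesis.ValiantsHypothesis.Theorems.TwistedDetRankSliceVBPFermionicDEvenHard

/-!
# Crux `TwistedDetRank.SliceVBPFermionic` (stmt-ValiantsHypothesis-17991, X2b) — the layer-switch
# gadget lands EXACTLY on the strategist's even-cycle family: `D^even_{4a}(laySubst) = G_a`

Theorems/TwistedDetRankSliceVBPFermionicDEvenGadgetCovers.lean gives
`D^even_{4a}(laySubst) = Σ_ρ (-1)^a sgn ρ · N(ρ) · Y^ρ` with `N(ρ) = #{s : Fin a → Bool | s ∘ ρ = ¬ s}`.
This file computes the count: `N(ρ) = 2^{numCycles ρ}` if `ρ` has no fixed point and all cycles even,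
`0` otherwise (`card_antiInvariant_eq`) — a `2`-colouring exists iff all cycles are even
(`exists_antiInvariant_of_allEven`, walking each cycle from a chosen representative; parity of the
walk is well defined because the cycle lengths are even), and then the `2`-colourings are a torsor
under the `ρ`-invariant colourings (xor with a fixed one), counted in `…DEvenHard`.  Hence the
coefficient is `evenCycleClass a ρ` on the nose (`dEven_coeff_eq_evenCycleClass`; `(-1)^a = 1`
because `a`, the sum of the even cycle lengths, is even) and

* `aeval_laySubstFin_eq_evenCycle`: `D^even_{4a}(laySubstFin) = G_a`, the GMF of `evenCycleClass`;
* `isProjection_evenCycle_dEven`: `G_a` is a Valiant PROJECTION of `D^even_{4a}`;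
* `hasDetRepr_evenCycle_of_dEven`: `dc(G_a) ≤ dc(D^even_{4a})` — a second route to the hardness of
  `D^even` through the tree's `not_dcPerSuperpolynomial_of_evenCycle_hasDetRepr`.

So the two families that the parent crux's STRATEGY-CENSUS and this crux's CALIBRATION.md listed as
separate survivors are one projection apart.  HONEST FRAMING: census work; X2b (≥ `VNP ⊄ VBP`) is
neither proved nor refuted; `VP ≠ VNP` is not moved.  References: L. G. Valiant, STOC 1979;
S. Mertens, C. Moore, Theory of Computing 9 (2013).
-/

-- single-conjunct layout: Sub = Summit, duplicated namespace component intended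
set_option linter.dupNamespace false

noncomputable section

namespace Summit.ValiantsHypothesis.ValiantsHypothesis.Theorems.TwistedDetRankSliceVBPFermionic

open Equiv Equiv.Perm MvPolynomial Literature.Computability.AlgebraicComplexity
open scoped BigOperators

section Colourings

variable {α : Type*} [Fintype α] [DecidableEq α]

/-- On one cycle, equal iterates from a moved point differ by a multiple of the cycle length; if
that length is even the exponents have the same parity. [folklore] -/
theorem even_iff_of_pow_apply_eq {ρ : Perm α} {y : α} (hy : ρ y ≠ y)
    (hl : Even (ρ.cycleOf y).support.card) {i j : ℕ} (h : (ρ ^ i) y = (ρ ^ j) y) :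
    (Even i ↔ Even j) := by
  wlog hij : i ≤ j generalizing i j
  · exact (this h.symm (le_of_not_ge hij)).symm
  obtain ⟨d, rfl⟩ := Nat.exists_eq_add_of_le hij
  have hd : (ρ ^ d) y = y := by
    rw [pow_add, Perm.mul_apply] at h
    exact ((ρ ^ i).injective h).symm
  have hdvd := card_support_cycleOf_dvd_of_pow_apply_eq_self hy hd
  have hde : Even d := (even_iff_two_dvd.1 hl).trans hdvd |> even_iff_two_dvd.2
  constructor
  · intro hi; exact hi.add hde
  · intro hij'; exact (Nat.even_add.1 hij').2 hde

/-- **An all-even permutation has a `2`-colouring** `s ∘ ρ = ¬ s`: colour `x` by the parity of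
the number of steps from a chosen representative of its cycle. [folklore] -/
theorem exists_antiInvariant_of_allEven (ρ : Perm α)
    (h : (∀ x, ρ x ≠ x) ∧ ∀ l ∈ ρ.cycleType, Even l) :
    ∃ s : α → Bool, ∀ x, s (ρ x) = !s x := by
  classical
  obtain ⟨hfix, heven⟩ := h
  -- representative of the cycle of `x` and a walk length from it
  let r : α → α := fun x => (DeRugyAltherre.orbitOf ρ x).out
  have hr : ∀ x, SameCycle ρ (r x) x := fun x =>
    (DeRugyAltherre.orbitOf_eq_orbitOf_iff ρ _ _).1 (Quotient.out_eq _)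
  have hrρ : ∀ x, r (ρ x) = r x := by
    intro x
    show (DeRugyAltherre.orbitOf ρ (ρ x)).out = (DeRugyAltherre.orbitOf ρ x).out
    congr 1
    exact (DeRugyAltherre.orbitOf_eq_orbitOf_iff ρ _ _).2 ((sameCycle_apply_left).2 SameCycle.rfl)
  have hn : ∀ x, ∃ n : ℕ, (ρ ^ n) (r x) = x := fun x => (hr x).exists_nat_pow_eq
  choose n hn using hn
  refine ⟨fun x => decide (Odd (n x)), fun x => ?_⟩
  -- `ρ^(n x + 1) (r x) = ρ x = ρ^(n (ρ x)) (r x)`, and the cycle of `r x` is even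
  have h1 : (ρ ^ (n x + 1)) (r x) = (ρ ^ n (ρ x)) (r x) := by
    rw [pow_succ', Perm.mul_apply, hn x, ← hrρ x, hn (ρ x)]
  have hry : ρ (r x) ≠ r x := hfix _
  have hl : Even (ρ.cycleOf (r x)).support.card :=
    heven _ (card_support_cycleOf_mem_cycleType hry)
  have hpar := even_iff_of_pow_apply_eq hry hl h1
  simp only
  by_cases hx : Odd (n x)
  · have : Even (n (ρ x)) := hpar.1 (hx.add_one)
    rw [decide_eq_true hx, decide_eq_false (Nat.not_odd_iff_even.2 this)]
    rfl
  · have hxe : Even (n x) := Nat.not_odd_iff_even.1 hx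
    have : ¬ Even (n (ρ x)) := fun h' => by
      have := hpar.2 h'
      exact (Nat.not_even_iff_odd.2 (hxe.add_one)) this
    rw [decide_eq_false hx, decide_eq_true (Nat.not_even_iff_odd.1 this)]
    rfl

/-- **The number of `2`-colourings of a permutation**: `2^{numCycles ρ}` if `ρ` has no fixed point
and all cycles even (the `2`-colourings are then a torsor under the invariant colourings), `0`
otherwise. [folklore] -/
theorem card_antiInvariant_eq (ρ : Perm α) [Fintype {s : α → Bool // ∀ x, s (ρ x) = !s x}]
    [Decidable ((∀ x, ρ x ≠ x) ∧ ∀ l ∈ ρ.cycleType, Even l)] :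
    Fintype.card {s : α → Bool // ∀ x, s (ρ x) = !s x} =
      if (∀ x, ρ x ≠ x) ∧ (∀ l ∈ ρ.cycleType, Even l) then 2 ^ ρ.numCycles else 0 := by
  classical
  split_ifs with h
  · obtain ⟨s₀, hs₀⟩ := exists_antiInvariant_of_allEven ρ h
    rw [← card_invariant_eq_two_pow_numCycles ρ]
    refine Fintype.card_congr
      { toFun := fun s => ⟨fun x => xor (s.1 x) (s₀ x), fun x => ?_⟩
        invFun := fun u => ⟨fun x => xor (u.1 x) (s₀ x), fun x => ?_⟩
        left_inv := fun s => Subtype.ext (funext fun x => by simp)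
        right_inv := fun u => Subtype.ext (funext fun x => by simp) }
    · simp only
      rw [s.2 x, hs₀ x, Bool.not_xor_not]
    · simp only
      rw [u.2 x, hs₀ x, Bool.xor_not]
  · exact Fintype.card_eq_zero_iff.2 ⟨fun s => h (allEven_of_antiInvariant s.1 s.2)⟩

end Colourings

section ToG

/-- An all-even permutation of `Fin a` forces `a` even (the cycle lengths sum to `a`). [folklore] -/
theorem even_of_allEven {a : ℕ} (ρ : Perm (Fin a))
    (h : (∀ x, ρ x ≠ x) ∧ ∀ l ∈ ρ.cycleType, Even l) : Even a := by
  have hsupp : ρ.support = Finset.univ := by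
    ext x; simp [Perm.mem_support, h.1 x]
  have hsum : ρ.cycleType.sum = a := by
    rw [sum_cycleType, hsupp, Finset.card_univ, Fintype.card_fin]
  rw [← hsum, even_iff_two_dvd]
  exact Multiset.dvd_sum fun l hl => even_iff_two_dvd.1 (h.2 l hl)

/-- **The gadget's coefficient is the even-cycle class function**:
`(-1)^a · sgn ρ · #{s : s ∘ ρ = ¬ s} = evenCycleClass a ρ`. [folklore] -/
theorem dEven_coeff_eq_evenCycleClass {a : ℕ} (ρ : Perm (Fin a)) :
    (-1) ^ a * ((Perm.sign ρ : ℤ) : ℂ) *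
        (Fintype.card {s : Fin a → Bool // ∀ i, s (ρ i) = !s i} : ℂ) = evenCycleClass a ρ := by
  classical
  unfold evenCycleClass
  rw [card_antiInvariant_eq]
  split_ifs with h
  · rw [(even_of_allEven ρ h).neg_one_pow, one_mul]
    push_cast
    ring
  · simp

/-- **`D^even_{4a}(laySubst) = G_a`**: the layer-switch gadget sends the GMF of `dEvenClass` on
`Fin (a·4)` exactly to the GMF of `evenCycleClass a` (the strategist's even-cycle family
`Σ_{σ all-even} sgn σ 2^{c(σ)} X^σ`). [folklore] -/
theorem aeval_laySubstFin_eq_evenCycle (a : ℕ) :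
    aeval (laySubstFin a) (∑ σ : Perm (Fin (a * 4)), C (dEvenClass σ) *
        ∏ k, (X (σ k, k) : MvPolynomial (Fin (a * 4) × Fin (a * 4)) ℂ)) =
      ∑ ρ : Perm (Fin a), C (evenCycleClass a ρ) *
        ∏ i, (X (ρ i, i) : MvPolynomial (Fin a × Fin a) ℂ) := by
  rw [aeval_laySubstFin_gmf]
  exact Finset.sum_congr rfl fun ρ _ => by rw [dEven_coeff_eq_evenCycleClass]

/-- **`G_a` is a Valiant projection of `D^even_{4a}`.** [folklore] -/
theorem isProjection_evenCycle_dEven (a : ℕ) :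
    IsProjection
      (∑ ρ : Perm (Fin a), C (evenCycleClass a ρ) *
        ∏ i, (X (ρ i, i) : MvPolynomial (Fin a × Fin a) ℂ))
      (∑ σ : Perm (Fin (a * 4)), C (dEvenClass σ) *
        ∏ k, (X (σ k, k) : MvPolynomial (Fin (a * 4) × Fin (a * 4)) ℂ)) :=
  ⟨laySubstFin a, laySubstFin_isVarOrConst, (aeval_laySubstFin_eq_evenCycle a).symm⟩

/-- **`dc(G_a) ≤ dc(D^even_{4a})`** — a second route to the hardness of `D^even`, through the tree's
`not_dcPerSuperpolynomial_of_evenCycle_hasDetRepr`. [folklore] -/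
theorem hasDetRepr_evenCycle_of_dEven {a m : ℕ}
    (h : HasDetRepr (∑ σ : Perm (Fin (a * 4)), C (dEvenClass σ) *
        ∏ k, (X (σ k, k) : MvPolynomial (Fin (a * 4) × Fin (a * 4)) ℂ)) m) :
    HasDetRepr (∑ ρ : Perm (Fin a), C (evenCycleClass a ρ) *
        ∏ i, (X (ρ i, i) : MvPolynomial (Fin a × Fin a) ℂ)) m := by
  rw [← aeval_laySubstFin_eq_evenCycle]
  exact hasDetRepr_aeval_linear h _ totalDegree_laySubstFin_le

end ToG

end Summit.ValiantsHypothesis.ValiantsHypothesis.Theorems.TwistedDetRankSliceVBPFermionic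

end
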